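import Summits.ResolutionOfSingularities.ResolutionOfSingularities.Theorems.HomologicalConductorNoZenoRelativeACC
import Summits.ResolutionOfSingularities.ResolutionOfSingularities.Theorems.HomologicalConductorNoZenoVacuity
import HarnessLib

/-!
# Crux `NoZenoR` (stmt-ResolutionOfSingularities-19943) — FLAG VACUITY: a non-terminating tower with a
# unit-creating coarsening whose unit values satisfy ACC refutes `StrictDrop` and hence PROVES the crux

OURS (cell res-hironaka, crux chain W4.4; lead res-L0-w44-lead-1 g19).  AI-written, weaker than expert review; nothing
here is a statement of the manuscript under review (Hironaka 2017).  SUPPORT-level, counted 0, def-free and fact-free.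

The tree's `NoZeno.Vacuity` records that a non-terminating ca-tower along a NOETHERIAN valuation ring refutes the binder
`StrictDrop` of `NoZenoR` and therefore proves the crux vacuously, so that «every K-side certificate must run along a
non-noetherian `O`».  This file widens the vacuous side to FLAGS (composite valuations): it is enough that SOME
coarsening `U ≥ O` (i) receives a unit from some `ca(T_m)` and (ii) has the ascending chain condition on `U`-unit values
in `O` — the contrapositive of the landed stub `NoZeno.Birth.stub_relativeACC` (p172572).  Typical instance (the
«rational flag» of a threefold germ): `O` = (prime divisor `D` ⊃ curve `C ⊂ D` ⊃ closed point), `U` = the rank-2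
coarsening along `(D, C)`; (ii) holds because `O/𝔪_U` is a discrete valuation ring of `κ(U)`, and (i) holds as soon as
one stage is regular at the centre of `U` (a curve germ outside the singular locus).  Consequence for the cell's K-side
programme: a tower that never terminates along such a flag closes the crux PROVED (vacuously) and refutes `StrictDrop`
(stmt-16485) — no value bookkeeping («origin rule», drift) is needed, only NON-TERMINATION.

* `not_strictDrop_of_nonterminating_of_unitCreating` — (i) ∧ (ii) ∧ «no stage regular» ⇒ `¬ StrictDrop`.
* `noZenoR_of_nonterminating_of_unitCreating` — … ⇒ `NoZenoR`.
* `not_strictDrop_and_termination_false_of_unitCreating` — the same read as a dichotomy: under (i) ∧ (ii),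
  `StrictDrop` forces a regular stage (this is `stub_relativeACC` itself, re-exported under the flag name).
-/

noncomputable section

-- single-problem summit: the doubled namespace component `ResolutionOfSingularities` is forced
set_option linter.dupNamespace false

namespace Summit.ResolutionOfSingularities.ResolutionOfSingularities.Theorems.NoZeno.FlagVacuity

open Summit.ResolutionOfSingularities.ResolutionOfSingularities.Theses.HomologicalConductor
open Summit.ResolutionOfSingularities.ResolutionOfSingularities.Theorems.NoZeno.Birth
open Summit.ResolutionOfSingularities.ResolutionOfSingularities.Theorems.NoZeno

/-- **Flag vacuity.**  Let `(p, k, K, O, A)` be an admissible datum of the route and `U ≥ O` a coarsening of `O`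
such that (i) some `ca(T_m)` holds a non-zero `U`-unit and (ii) `O` has no infinite strictly ascending chain of
principal ideals generated by `U`-units (every sequence `zₙ ∈ O ∖ 0` of `U`-units with `zₙ · zₙ₊₁⁻¹ ∈ O` has some
`zₙ₊₁ · zₙ⁻¹ ∈ O`).  If NO stage `tower O A m` is a regular local ring, then `StrictDrop` is false (contrapositive of
`NoZeno.Birth.stub_relativeACC`). [this work] -/
theorem not_strictDrop_of_nonterminating_of_unitCreating (p : ℕ) (hp : p.Prime) (k K : Type) [Field k]
    [CharP k p] [Field K] [Algebra k K] (O : ValuationSubring K) (A : Subalgebra k K)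
    (hk : ∀ c : k, algebraMap k K c ∈ O) (hA : A.FG) (hfr : IsFractionRing ↥A K)
    (hAO : A.toSubring ≤ O.toSubring) (U : ValuationSubring K) (hOU : O ≤ U)
    (hunit : ∃ m : ℕ, ∃ c ∈ ca (tower O A m), c ≠ 0 ∧ c⁻¹ ∈ U)
    (hacc : ∀ z : ℕ → K, (∀ n : ℕ, z n ∈ O ∧ z n ≠ 0 ∧ (z n)⁻¹ ∈ U) →
      (∀ n : ℕ, z n * (z (n + 1))⁻¹ ∈ O) → ∃ n : ℕ, z (n + 1) * (z n)⁻¹ ∈ O)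
    (h : ∀ m : ℕ, ¬ IsRegularLocalRing ↥(tower O A m)) : ¬ StrictDrop := by
  intro hD
  obtain ⟨m, hm⟩ := stub_relativeACC hD p hp k K O A hk hA hfr hAO U hOU hunit hacc
  exact h m hm

/-- **… and therefore PROVES the crux `NoZenoR` (vacuously)**: a tower that never terminates along a valuation with a
unit-creating coarsening satisfying ACC on unit values (e.g. a rational flag «prime divisor ⊃ curve ⊃ point» whose
curve is generically a regular point of some stage) closes stmt-19943 on the S-side. [this work] -/
theorem noZenoR_of_nonterminating_of_unitCreating (p : ℕ) (hp : p.Prime) (k K : Type) [Field k]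
    [CharP k p] [Field K] [Algebra k K] (O : ValuationSubring K) (A : Subalgebra k K)
    (hk : ∀ c : k, algebraMap k K c ∈ O) (hA : A.FG) (hfr : IsFractionRing ↥A K)
    (hAO : A.toSubring ≤ O.toSubring) (U : ValuationSubring K) (hOU : O ≤ U)
    (hunit : ∃ m : ℕ, ∃ c ∈ ca (tower O A m), c ≠ 0 ∧ c⁻¹ ∈ U)
    (hacc : ∀ z : ℕ → K, (∀ n : ℕ, z n ∈ O ∧ z n ≠ 0 ∧ (z n)⁻¹ ∈ U) →
      (∀ n : ℕ, z n * (z (n + 1))⁻¹ ∈ O) → ∃ n : ℕ, z (n + 1) * (z n)⁻¹ ∈ O)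
    (h : ∀ m : ℕ, ¬ IsRegularLocalRing ↥(tower O A m)) : NoZenoR :=
  Vacuity.noZenoR_of_not_strictDrop
    (not_strictDrop_of_nonterminating_of_unitCreating p hp k K O A hk hA hfr hAO U hOU hunit hacc h)

/-- **The same with the trivial coarsening `U = O` noetherian** is the tree's
`Vacuity.not_strictDrop_of_nonterminating_of_isNoetherianRing`; recorded here is the general dichotomy form: under (i) ∧ (ii),
EITHER some stage is regular OR `StrictDrop` fails — «both the kill test and the crux refuted» is impossible along such flags.
[this work] -/
theorem isRegularLocalRing_or_not_strictDrop_of_unitCreating (p : ℕ) (hp : p.Prime) (k K : Type) [Field k]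
    [CharP k p] [Field K] [Algebra k K] (O : ValuationSubring K) (A : Subalgebra k K)
    (hk : ∀ c : k, algebraMap k K c ∈ O) (hA : A.FG) (hfr : IsFractionRing ↥A K)
    (hAO : A.toSubring ≤ O.toSubring) (U : ValuationSubring K) (hOU : O ≤ U)
    (hunit : ∃ m : ℕ, ∃ c ∈ ca (tower O A m), c ≠ 0 ∧ c⁻¹ ∈ U)
    (hacc : ∀ z : ℕ → K, (∀ n : ℕ, z n ∈ O ∧ z n ≠ 0 ∧ (z n)⁻¹ ∈ U) →
      (∀ n : ℕ, z n * (z (n + 1))⁻¹ ∈ O) → ∃ n : ℕ, z (n + 1) * (z n)⁻¹ ∈ O) :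
    (∃ m : ℕ, IsRegularLocalRing ↥(tower O A m)) ∨ ¬ StrictDrop := by
  by_cases h : ∃ m : ℕ, IsRegularLocalRing ↥(tower O A m)
  · exact Or.inl h
  · push Not at h
    exact Or.inr (not_strictDrop_of_nonterminating_of_unitCreating p hp k K O A hk hA hfr hAO U hOU hunit hacc h)

end Summit.ResolutionOfSingularities.ResolutionOfSingularities.Theorems.NoZeno.FlagVacuity

end
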